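import Summits.CriticalPhenomena.SAWScalingLimit.Theses.SAWMassiveIsingTilt
import Summits.CriticalPhenomena.SAWScalingLimit.Theorems.SAWMassiveIsingTiltDefs
import Literature.Probability.RandomPlanarGeometry.ConformalRestrictionHolds
import Literature.Probability.RandomPlanarGeometry.ConformalRestrictionLocal
import Literature.Probability.RandomPlanarGeometry.HullRestrictionSLEHolds
import Literature.Probability.RandomPlanarGeometry.CritPercSLESimplePathHolds
import Literature.Probability.RandomPlanarGeometry.SLEExistenceNeEightHolds
import Summits.CriticalPhenomena.SAWScalingLimit.Theorems.SAWMassiveIsingTiltTiltLawBasic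
import Summits.CriticalPhenomena.SAWScalingLimit.Theorems.SAWMassiveIsingTiltMassiveWindowSLEStubHullRestrictionOfDefect
import Literature.Probability.RandomPlanarGeometry.EmbSAWRestrictionCovariance
import HarnessLib

/-!
# Crux `MassiveWindowSLE` (stmt-CriticalPhenomena-7685), line `registered` (skeleton r6):
stub `stub_windowRestrictionDefect_of_mixing` — nesting + ratio mixing of `Zloop` ⇒ defect

Route `SAWMassiveIsingTilt` of `CriticalPhenomena/SAWScalingLimit`; stub R (reduction) of the
line `registered`, the r6 split `2a = R(N, M)` found by the wave-1 audit of r5's stub 2a. Objects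
(`Theorems/SAWMassiveIsingTiltDefs.lean`): the bath factor `Zloop (hexDomainGraph Ω δ) S y`
(loop-gas partition function of `Ω_δ` inside the vertex set `S`), the tilted weight
`tilt Ω δ x y a b = Σ_γ (x^{ℓ(γ)} · Zloop(Ω_δ ∖ γ; y))⁺ δ_γ` on the SAWs of `Ω_δ ⊆ δℍ` from `a`
to `b`, the tilted law `tiltLaw = (tilt univ)⁻¹ • tilt` pushed to `CurveClass ℂ` by `γ ↦ γ.curve`;
a hull pair `D' ⊆ D`, the removed hull `K = cl (D ∖ D')`, the open event
`O_ε = {γ | ∀ z ∈ range γ, ∀ k ∈ K, ε < dist z k}`, the window weight `y(δ) = 1/√3 − m δ·δ`.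

* `wrm_mul_tilt_le_mul_tilt` — weighted support-preserving injections: if every walk of
  `S₁ ⊆ SAW(Ω₁_δ)` is, with the same support, a walk of `S₂ ⊆ SAW(Ω₂_δ)` with tilted weights
  compared as `c₁ w₁ ≤ c₂ w₂`, then `c₁ · tilt₁ S₁ ≤ c₂ · tilt₂ S₂` (a SAW is determined by its
  support, `SAW.EmbDomainSAW.ext_support`).
* `wrm_defect_of_ratioMixing` — FIXED `δ`: nesting ((i) `Ω'_δ`-walks are `Ω_δ`-walks, (ii)
  `Ω_δ`-walks with curve in `O` are `Ω'_δ`-walks, with the same supports) and a pinned two-sided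
  bound `r₀ Z' ≤ Z ≤ (1 + θ) r₀ Z'` on the bath factors of the `O`-walks give the two-sided
  comparison of the push-forward laws on `O` with ONE constant `q = Z_Ω⁻¹ Z_Ω' r₀` (`q = 0` in
  the junk cases `Z_Ω ∈ {0, ⊤}`, `Z_Ω' = 0`). The tilt `x^ℓ` cancels walk by walk whatever its
  sign (`wrm_ofReal_mul_le`; same support ⇒ same `ℓ`,
  `SAW.EmbDomainSAW.vertexCount_eq_of_support_eq`).
* `wrm_pinned_of_pairwise` — the pairwise "ratio of ratios" form
  `Z(γ₁) Z'(γ₂) ≤ (1 + θ) Z'(γ₁) Z(γ₂)` pins `r₀ :=` the minimal ratio `Z/Z'` over the finitely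
  many `O`-walks.
* `stub_windowRestrictionDefect_of_mixing` — the registered signature: NESTING (stub N) →
  MIXING (stub M) → the restriction defect, eventually as `δ → 0⁺` along a fast window schedule
  (`y(δ) ≥ 0` eventually since `m δ·δ → 0`, so `1 ≤ Zloop` by `one_le_zloop`; finitely many
  SAWs, `finite_hexDomainSAW`; `O_ε` is open, `hrd_isOpen_avoid`, hence measurable).

References: G. F. Lawler, O. Schramm, W. Werner, *Conformal restriction: the chordal case*,
J. Amer. Math. Soc. 16 (2003), §3 (restriction covariance of the SAW measure, discrete form). No
named fact is used; axioms `propext`, `Classical.choice`, `Quot.sound`.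
-/

noncomputable section

open MeasureTheory Filter Topology Set
open scoped NNReal ENNReal
open Literature.Probability Literature.Probability.LatticeModels
  Literature.Probability.RandomPlanarGeometry
open Summit.CriticalPhenomena.SAWScalingLimit.Theorems.SAWMassiveIsingTilt

namespace Summit.CriticalPhenomena.SAWScalingLimit.Theorems.MassiveWindowSLE.Birth

section Reduction

variable {Ω Ω' : Set ℂ} {δ x y : ℝ} {a b : HexVertex}

/-- The tilted weight of a set of SAWs is the sum of the tilted weights of its members. -/
theorem wrm_tilt_apply_eq_tsum (S : Set (SAW.HexDomainSAW Ω δ a b)) :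
    tilt Ω δ x y a b S = ∑' γ, S.indicator (fun γ : SAW.HexDomainSAW Ω δ a b => ENNReal.ofReal
      (x ^ γ.vertexCount * Zloop (SAW.hexDomainGraph Ω δ) {v | v ∉ γ.walk.support} y)) γ := by
  rw [tilt, Measure.sum_apply _ MeasurableSpace.measurableSet_top]
  refine tsum_congr fun γ => ?_
  rw [Measure.smul_apply, Measure.dirac_apply' _ MeasurableSpace.measurableSet_top, smul_eq_mul]
  by_cases h : γ ∈ S <;> simp [h]

/-- **Weighted support-preserving injections** (the tilted version of
`SAW.embWeight_le_embWeight_of_forall_exists_support_eq`): if every walk of `S₁ ⊆ SAW(Ω₁_δ)` is,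
with the same support, a walk of `S₂ ⊆ SAW(Ω₂_δ)`, with tilted weights compared as
`c₁ w₁(γ₁) ≤ c₂ w₂(γ₂)`, then `c₁ · tilt Ω₁ S₁ ≤ c₂ · tilt Ω₂ S₂`. -/
theorem wrm_mul_tilt_le_mul_tilt {Ω₁ Ω₂ : Set ℂ} (c₁ c₂ : ℝ≥0∞)
    {S₁ : Set (SAW.HexDomainSAW Ω₁ δ a b)} {S₂ : Set (SAW.HexDomainSAW Ω₂ δ a b)}
    (h : ∀ γ₁ ∈ S₁, ∃ γ₂ ∈ S₂, γ₂.walk.support = γ₁.walk.support ∧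
      c₁ * ENNReal.ofReal (x ^ γ₁.vertexCount *
          Zloop (SAW.hexDomainGraph Ω₁ δ) {v | v ∉ γ₁.walk.support} y) ≤
        c₂ * ENNReal.ofReal (x ^ γ₂.vertexCount *
          Zloop (SAW.hexDomainGraph Ω₂ δ) {v | v ∉ γ₂.walk.support} y)) :
    c₁ * tilt Ω₁ δ x y a b S₁ ≤ c₂ * tilt Ω₂ δ x y a b S₂ := by
  classical
  set w₁ : SAW.HexDomainSAW Ω₁ δ a b → ℝ≥0∞ := fun γ => ENNReal.ofReal (x ^ γ.vertexCount *
      Zloop (SAW.hexDomainGraph Ω₁ δ) {v | v ∉ γ.walk.support} y) with hw₁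
  set w₂ : SAW.HexDomainSAW Ω₂ δ a b → ℝ≥0∞ := fun γ => ENNReal.ofReal (x ^ γ.vertexCount *
      Zloop (SAW.hexDomainGraph Ω₂ δ) {v | v ∉ γ.walk.support} y) with hw₂
  rw [wrm_tilt_apply_eq_tsum, wrm_tilt_apply_eq_tsum]
  change c₁ * ∑' γ, S₁.indicator w₁ γ ≤ c₂ * ∑' γ, S₂.indicator w₂ γ
  rw [← tsum_subtype S₁ w₁, ← ENNReal.tsum_mul_left, ← ENNReal.tsum_mul_left]
  have hex : ∀ γ₁ : S₁, ∃ γ₂ ∈ S₂, γ₂.walk.support = γ₁.1.walk.support ∧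
      c₁ * w₁ γ₁.1 ≤ c₂ * w₂ γ₂ := fun γ₁ => h γ₁.1 γ₁.2
  choose ι hιS hι hle using hex
  have hinj : Function.Injective ι := by
    intro γ γ' hγ
    apply Subtype.ext
    apply SAW.EmbDomainSAW.ext_support
    rw [← hι γ, ← hι γ', hγ]
  calc ∑' γ₁ : S₁, c₁ * w₁ γ₁.1 ≤ ∑' γ₁ : S₁, c₂ * S₂.indicator w₂ (ι γ₁) := by
        refine ENNReal.tsum_le_tsum fun γ₁ => ?_
        rw [Set.indicator_of_mem (hιS γ₁)]
        exact hle γ₁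
    _ ≤ ∑' γ₂, c₂ * S₂.indicator w₂ γ₂ :=
        ENNReal.tsum_comp_le_tsum_of_injective hinj (fun γ₂ => c₂ * S₂.indicator w₂ γ₂)

/-- Sign bookkeeping for the tilt `x ^ ℓ` (the SAME for a walk read in two domains): from
`c A ≤ c' B` with `A, c, c' ≥ 0` one gets `c · (x^ℓ A)⁺ ≤ c' · (x^ℓ B)⁺` whatever the sign of
`x ^ ℓ` (both sides vanish when `x ^ ℓ ≤ 0`). So `x δ < 0` creates no parity effect. -/
theorem wrm_ofReal_mul_le {p A B c c' : ℝ} (hc : 0 ≤ c) (hc' : 0 ≤ c') (hA : 0 ≤ A)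
    (h : c * A ≤ c' * B) :
    ENNReal.ofReal c * ENNReal.ofReal (p * A) ≤ ENNReal.ofReal c' * ENNReal.ofReal (p * B) := by
  rcases le_or_gt p 0 with hp | hp
  · have : p * A ≤ 0 := mul_nonpos_of_nonpos_of_nonneg hp hA
    rw [ENNReal.ofReal_of_nonpos this, mul_zero]
    exact zero_le
  · rw [← ENNReal.ofReal_mul hc, ← ENNReal.ofReal_mul hc']
    refine ENNReal.ofReal_le_ofReal ?_
    calc c * (p * A) = p * (c * A) := by ring
      _ ≤ p * (c' * B) := mul_le_mul_of_nonneg_left h hp.le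
      _ = c' * (p * B) := by ring

/-- Over a finite SAW set the total tilted weight is finite. -/
theorem wrm_tilt_univ_ne_top [Finite (SAW.HexDomainSAW Ω δ a b)] :
    tilt Ω δ x y a b Set.univ ≠ ∞ := by
  classical
  haveI := Fintype.ofFinite (SAW.HexDomainSAW Ω δ a b)
  rw [tilt_univ_eq_sum]
  exact ENNReal.sum_ne_top.2 fun _ _ => ENNReal.ofReal_ne_top

/-- **REDUCTION at fixed `δ`.** Two carriers, common endpoints, finitely many SAWs in each,
`1 ≤ Zloop` on every vertex set for both discrete domains (e.g. `y ≥ 0`, bounded carriers,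
`δ ≠ 0`: `one_le_zloop`), a measurable event `O` of curve classes, NESTING ((i) every
`Ω'_δ`-walk is an `Ω_δ`-walk with the same support; (ii) every `Ω_δ`-walk with curve in `O` is
an `Ω'_δ`-walk with the same support), and TWO-SIDED RATIO MIXING on `O`: one constant `r₀ > 0`
with `r₀ Zloop(Ω'_δ ∖ γ') ≤ Zloop(Ω_δ ∖ γ') ≤ (1 + θ) r₀ Zloop(Ω'_δ ∖ γ')` for every
`Ω'_δ`-walk `γ'` with curve in `O` (here `Zloop(Ω_δ ∖ γ) = Zloop (hexDomainGraph Ω δ)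
{v | v ∉ γ.support} y`, exactly the bath factor of `tilt`). THEN the registered two-sided
comparison holds on `O` with ONE constant `q` (namely `q = Z_Ω⁻¹ Z_Ω' r₀`, or `0` in the junk
cases). The tilt `x ^ ℓ(γ)` cancels walk by walk, whatever its sign. -/
theorem wrm_defect_of_ratioMixing (O : Set (CurveClass ℂ)) (hO : MeasurableSet O) {θ : ℝ}
    (hθ : 0 ≤ θ) [Finite (SAW.HexDomainSAW Ω δ a b)] [Finite (SAW.HexDomainSAW Ω' δ a b)]
    (hZ : ∀ S, 1 ≤ Zloop (SAW.hexDomainGraph Ω δ) S y)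
    (hZ' : ∀ S, 1 ≤ Zloop (SAW.hexDomainGraph Ω' δ) S y)
    (hN₁ : ∀ γ' : SAW.HexDomainSAW Ω' δ a b,
      ∃ γ : SAW.HexDomainSAW Ω δ a b, γ.walk.support = γ'.walk.support)
    (hN₂ : ∀ γ : SAW.HexDomainSAW Ω δ a b, γ.curve ∈ O →
      ∃ γ' : SAW.HexDomainSAW Ω' δ a b, γ'.walk.support = γ.walk.support)
    {r₀ : ℝ} (hr₀ : 0 < r₀)
    (hmix : ∀ γ' : SAW.HexDomainSAW Ω' δ a b, γ'.curve ∈ O →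
      r₀ * Zloop (SAW.hexDomainGraph Ω' δ) {v | v ∉ γ'.walk.support} y ≤
          Zloop (SAW.hexDomainGraph Ω δ) {v | v ∉ γ'.walk.support} y ∧
        Zloop (SAW.hexDomainGraph Ω δ) {v | v ∉ γ'.walk.support} y ≤
          (1 + θ) * r₀ * Zloop (SAW.hexDomainGraph Ω' δ) {v | v ∉ γ'.walk.support} y) :
    ∃ q : ℝ≥0, ∀ B : Set (CurveClass ℂ), MeasurableSet B →
      (Measure.map (fun γ : SAW.HexDomainSAW Ω δ a b => γ.curve) (tiltLaw Ω δ x y a b)) (B ∩ O) ≤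
          ENNReal.ofReal (1 + θ) * (q : ℝ≥0∞) *
            (Measure.map (fun γ : SAW.HexDomainSAW Ω' δ a b => γ.curve) (tiltLaw Ω' δ x y a b))
              (B ∩ O) ∧
        (q : ℝ≥0∞) *
            (Measure.map (fun γ : SAW.HexDomainSAW Ω' δ a b => γ.curve) (tiltLaw Ω' δ x y a b))
              (B ∩ O) ≤
          ENNReal.ofReal (1 + θ) *
            (Measure.map (fun γ : SAW.HexDomainSAW Ω δ a b => γ.curve) (tiltLaw Ω δ x y a b))
              (B ∩ O) := by
  classical
  set Z := tilt Ω δ x y a b Set.univ with hZdef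
  set Z' := tilt Ω' δ x y a b Set.univ with hZ'def
  have hmeas : Measurable fun γ : SAW.HexDomainSAW Ω δ a b => γ.curve :=
    SAW.EmbDomainSAW.measurable_of_top _
  have hmeas' : Measurable fun γ : SAW.HexDomainSAW Ω' δ a b => γ.curve :=
    SAW.EmbDomainSAW.measurable_of_top _
  have hν : ∀ B : Set (CurveClass ℂ), MeasurableSet B →
      (Measure.map (fun γ : SAW.HexDomainSAW Ω δ a b => γ.curve) (tiltLaw Ω δ x y a b)) (B ∩ O) =
        Z⁻¹ * tilt Ω δ x y a b {γ | γ.curve ∈ B ∩ O} := by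
    intro B hB
    rw [Measure.map_apply hmeas (hB.inter hO), tiltLaw, Measure.smul_apply, smul_eq_mul]
    rfl
  have hν' : ∀ B : Set (CurveClass ℂ), MeasurableSet B →
      (Measure.map (fun γ : SAW.HexDomainSAW Ω' δ a b => γ.curve) (tiltLaw Ω' δ x y a b))
          (B ∩ O) =
        Z'⁻¹ * tilt Ω' δ x y a b {γ | γ.curve ∈ B ∩ O} := by
    intro B hB
    rw [Measure.map_apply hmeas' (hB.inter hO), tiltLaw, Measure.smul_apply, smul_eq_mul]
    rfl
  -- the two weight comparisons on sub-events of `O` (tilt cancels, bath ratio pinned by `r₀`)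
  have hcmp₁ : ∀ S : Set (CurveClass ℂ), S ⊆ O →
      1 * tilt Ω δ x y a b {γ | γ.curve ∈ S} ≤
        ENNReal.ofReal ((1 + θ) * r₀) * tilt Ω' δ x y a b {γ' | γ'.curve ∈ S} := by
    intro S hS
    rw [← ENNReal.ofReal_one]
    refine wrm_mul_tilt_le_mul_tilt _ _ fun γ hγ => ?_
    obtain ⟨γ', hγ'⟩ := hN₂ γ (hS hγ)
    have hcurve : γ'.curve = γ.curve := SAW.EmbDomainSAW.curve_eq_of_support_eq hγ'
    have hvc : γ'.vertexCount = γ.vertexCount := SAW.EmbDomainSAW.vertexCount_eq_of_support_eq hγ'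
    have hO' : γ'.curve ∈ O := by rw [hcurve]; exact hS hγ
    obtain ⟨-, h2⟩ := hmix γ' hO'
    refine ⟨γ', show γ'.curve ∈ S by rw [hcurve]; exact hγ, hγ', ?_⟩
    rw [hvc, hγ']
    rw [hγ'] at h2
    exact wrm_ofReal_mul_le zero_le_one (by positivity) (zero_le_one.trans (hZ _))
      (by rw [one_mul]; exact h2)
  have hcmp₂ : ∀ S : Set (CurveClass ℂ), S ⊆ O →
      ENNReal.ofReal r₀ * tilt Ω' δ x y a b {γ' | γ'.curve ∈ S} ≤
        ENNReal.ofReal (1 + θ) * tilt Ω δ x y a b {γ | γ.curve ∈ S} := by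
    intro S hS
    refine wrm_mul_tilt_le_mul_tilt _ _ fun γ' hγ' => ?_
    obtain ⟨γ, hγ⟩ := hN₁ γ'
    have hcurve : γ.curve = γ'.curve := SAW.EmbDomainSAW.curve_eq_of_support_eq hγ
    have hvc : γ.vertexCount = γ'.vertexCount := SAW.EmbDomainSAW.vertexCount_eq_of_support_eq hγ
    obtain ⟨h1, -⟩ := hmix γ' (hS hγ')
    refine ⟨γ, show γ.curve ∈ S by rw [hcurve]; exact hγ', hγ, ?_⟩
    rw [hvc, hγ]
    refine wrm_ofReal_mul_le hr₀.le (by linarith) (zero_le_one.trans (hZ' _)) ?_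
    calc r₀ * Zloop (SAW.hexDomainGraph Ω' δ) {v | v ∉ γ'.walk.support} y
        ≤ Zloop (SAW.hexDomainGraph Ω δ) {v | v ∉ γ'.walk.support} y := h1
      _ = 1 * Zloop (SAW.hexDomainGraph Ω δ) {v | v ∉ γ'.walk.support} y := (one_mul _).symm
      _ ≤ (1 + θ) * Zloop (SAW.hexDomainGraph Ω δ) {v | v ∉ γ'.walk.support} y :=
          mul_le_mul_of_nonneg_right (by linarith) (zero_le_one.trans (hZ _))
  -- junk case 1: the big-domain law is the zero measure
  by_cases hZ0 : Z = 0 ∨ Z = ∞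
  · refine ⟨0, fun B hB => ?_⟩
    have h0 : Z⁻¹ * tilt Ω δ x y a b {γ | γ.curve ∈ B ∩ O} = 0 := by
      rcases hZ0 with h | h
      · have : tilt Ω δ x y a b {γ | γ.curve ∈ B ∩ O} = 0 :=
          le_antisymm (h ▸ measure_mono (Set.subset_univ _)) zero_le
        rw [this, mul_zero]
      · rw [h, ENNReal.inv_top, zero_mul]
    rw [hν B hB, h0]
    simp
  -- junk case 2: the small-domain law is the zero measure; then `ν` does not charge `O` either
  have hZ'top : Z' ≠ ∞ := wrm_tilt_univ_ne_top
  by_cases hZ'0 : Z' = 0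
  · refine ⟨0, fun B hB => ?_⟩
    have h0 : tilt Ω δ x y a b {γ | γ.curve ∈ B ∩ O} = 0 := by
      have h := hcmp₁ (B ∩ O) Set.inter_subset_right
      rw [one_mul] at h
      refine le_antisymm (h.trans ?_) zero_le
      have : tilt Ω' δ x y a b {γ' | γ'.curve ∈ B ∩ O} = 0 :=
        le_antisymm (hZ'0 ▸ measure_mono (Set.subset_univ _)) zero_le
      rw [this, mul_zero]
    rw [hν B hB, h0]
    simp
  -- main case: both laws are honest normalised weights
  rw [not_or] at hZ0
  have hZinv : Z⁻¹ ≠ ∞ := ENNReal.inv_ne_top.2 hZ0.1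
  set qE : ℝ≥0∞ := Z⁻¹ * Z' * ENNReal.ofReal r₀ with hqE
  have hqEtop : qE ≠ ∞ := ENNReal.mul_ne_top (ENNReal.mul_ne_top hZinv hZ'top) ENNReal.ofReal_ne_top
  refine ⟨qE.toNNReal, fun B hB => ?_⟩
  rw [ENNReal.coe_toNNReal hqEtop, hν B hB, hν' B hB]
  constructor
  · have h := hcmp₁ (B ∩ O) Set.inter_subset_right
    rw [one_mul] at h
    calc Z⁻¹ * tilt Ω δ x y a b {γ | γ.curve ∈ B ∩ O}
        ≤ Z⁻¹ * (ENNReal.ofReal ((1 + θ) * r₀) * tilt Ω' δ x y a b {γ' | γ'.curve ∈ B ∩ O}) :=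
          by gcongr
      _ = Z⁻¹ * (ENNReal.ofReal (1 + θ) * ENNReal.ofReal r₀) * 1 *
            tilt Ω' δ x y a b {γ' | γ'.curve ∈ B ∩ O} := by
          rw [ENNReal.ofReal_mul (by linarith)]; ring
      _ = ENNReal.ofReal (1 + θ) * qE * (Z'⁻¹ * tilt Ω' δ x y a b {γ | γ.curve ∈ B ∩ O}) := by
          rw [← ENNReal.mul_inv_cancel hZ'0 hZ'top, hqE]; ring
  · have h := hcmp₂ (B ∩ O) Set.inter_subset_right
    calc qE * (Z'⁻¹ * tilt Ω' δ x y a b {γ | γ.curve ∈ B ∩ O})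
        = Z⁻¹ * (Z' * Z'⁻¹) * (ENNReal.ofReal r₀ * tilt Ω' δ x y a b {γ' | γ'.curve ∈ B ∩ O}) := by
          rw [hqE]; ring
      _ = Z⁻¹ * (ENNReal.ofReal r₀ * tilt Ω' δ x y a b {γ' | γ'.curve ∈ B ∩ O}) := by
          rw [ENNReal.mul_inv_cancel hZ'0 hZ'top, mul_one]
      _ ≤ Z⁻¹ * (ENNReal.ofReal (1 + θ) * tilt Ω δ x y a b {γ | γ.curve ∈ B ∩ O}) :=
          by gcongr
      _ = ENNReal.ofReal (1 + θ) * (Z⁻¹ * tilt Ω δ x y a b {γ | γ.curve ∈ B ∩ O}) := by ring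

/-- **Pairwise ("ratio of ratios") form ⇒ pinned form.** If for all `Ω'_δ`-walks `γ₁, γ₂` with
curve in `O` the bath ratios satisfy `Z(γ₁) Z'(γ₂) ≤ (1 + θ) Z'(γ₁) Z(γ₂)` (`Z = Zloop` in `Ω_δ`,
`Z' = Zloop` in `Ω'_δ`, both off the walk), then one constant `r₀ > 0` (the minimal ratio over the
finitely many such walks) pins `r₀ Z' ≤ Z ≤ (1 + θ) r₀ Z'` — the hypothesis `hmix` of
`wrm_defect_of_ratioMixing`. -/
theorem wrm_pinned_of_pairwise [Finite (SAW.HexDomainSAW Ω' δ a b)] (O : Set (CurveClass ℂ))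
    {θ : ℝ} (hZ : ∀ S, 1 ≤ Zloop (SAW.hexDomainGraph Ω δ) S y)
    (hZ' : ∀ S, 1 ≤ Zloop (SAW.hexDomainGraph Ω' δ) S y)
    (hpair : ∀ γ₁ γ₂ : SAW.HexDomainSAW Ω' δ a b, γ₁.curve ∈ O → γ₂.curve ∈ O →
      Zloop (SAW.hexDomainGraph Ω δ) {v | v ∉ γ₁.walk.support} y *
          Zloop (SAW.hexDomainGraph Ω' δ) {v | v ∉ γ₂.walk.support} y ≤
        (1 + θ) * (Zloop (SAW.hexDomainGraph Ω' δ) {v | v ∉ γ₁.walk.support} y *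
          Zloop (SAW.hexDomainGraph Ω δ) {v | v ∉ γ₂.walk.support} y)) :
    ∃ r₀ : ℝ, 0 < r₀ ∧ ∀ γ' : SAW.HexDomainSAW Ω' δ a b, γ'.curve ∈ O →
      r₀ * Zloop (SAW.hexDomainGraph Ω' δ) {v | v ∉ γ'.walk.support} y ≤
          Zloop (SAW.hexDomainGraph Ω δ) {v | v ∉ γ'.walk.support} y ∧
        Zloop (SAW.hexDomainGraph Ω δ) {v | v ∉ γ'.walk.support} y ≤
          (1 + θ) * r₀ * Zloop (SAW.hexDomainGraph Ω' δ) {v | v ∉ γ'.walk.support} y := by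
  classical
  haveI := Fintype.ofFinite (SAW.HexDomainSAW Ω' δ a b)
  -- the ratio `ρ = Z / Z'` and the finite set of walks with curve in `O`
  let ρ : SAW.HexDomainSAW Ω' δ a b → ℝ := fun γ' =>
    Zloop (SAW.hexDomainGraph Ω δ) {v | v ∉ γ'.walk.support} y /
      Zloop (SAW.hexDomainGraph Ω' δ) {v | v ∉ γ'.walk.support} y
  let W : Finset (SAW.HexDomainSAW Ω' δ a b) := Finset.univ.filter fun γ' => γ'.curve ∈ O
  have hpos : ∀ γ' : SAW.HexDomainSAW Ω' δ a b,
      0 < Zloop (SAW.hexDomainGraph Ω δ) {v | v ∉ γ'.walk.support} y := fun γ' =>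
    one_pos.trans_le (hZ _)
  have hpos' : ∀ γ' : SAW.HexDomainSAW Ω' δ a b,
      0 < Zloop (SAW.hexDomainGraph Ω' δ) {v | v ∉ γ'.walk.support} y := fun γ' =>
    one_pos.trans_le (hZ' _)
  by_cases hWne : W.Nonempty
  · obtain ⟨γ₀, hγ₀W, hmin⟩ := Finset.exists_min_image W ρ hWne
    have hγ₀O : γ₀.curve ∈ O := (Finset.mem_filter.1 hγ₀W).2
    refine ⟨ρ γ₀, div_pos (hpos γ₀) (hpos' γ₀), fun γ' hγ' => ⟨?_, ?_⟩⟩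
    · have h := hmin γ' (Finset.mem_filter.2 ⟨Finset.mem_univ _, hγ'⟩)
      calc ρ γ₀ * Zloop (SAW.hexDomainGraph Ω' δ) {v | v ∉ γ'.walk.support} y
          ≤ ρ γ' * Zloop (SAW.hexDomainGraph Ω' δ) {v | v ∉ γ'.walk.support} y :=
            mul_le_mul_of_nonneg_right h (hpos' γ').le
        _ = Zloop (SAW.hexDomainGraph Ω δ) {v | v ∉ γ'.walk.support} y :=
            div_mul_cancel₀ _ (hpos' γ').ne'
    · have h := hpair γ' γ₀ hγ' hγ₀O
      rw [show (1 + θ) * ρ γ₀ * Zloop (SAW.hexDomainGraph Ω' δ) {v | v ∉ γ'.walk.support} y =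
          (1 + θ) * (Zloop (SAW.hexDomainGraph Ω' δ) {v | v ∉ γ'.walk.support} y *
            Zloop (SAW.hexDomainGraph Ω δ) {v | v ∉ γ₀.walk.support} y) /
            Zloop (SAW.hexDomainGraph Ω' δ) {v | v ∉ γ₀.walk.support} y from by
        simp only [ρ]; ring]
      exact (le_div_iff₀ (hpos' γ₀)).2 h
  · exact ⟨1, one_pos, fun γ' hγ' =>
      absurd ⟨γ', Finset.mem_filter.2 ⟨Finset.mem_univ _, hγ'⟩⟩ hWne⟩

end Reduction

/-- **Stub R (reduction): nesting + ratio mixing ⇒ the restriction defect** (the registered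
signature; r5's `stub_windowRestrictionDefect` verbatim as the conclusion). Given NESTING along
common endpoints (stub N, first hypothesis) and window-uniform two-sided RATIO MIXING of `Zloop` in
the pairwise form (stub M, second hypothesis): along a fast schedule, for a hull pair `D' ⊆ D`,
common endpoint approximations and `ε, θ > 0`, eventually as `δ → 0⁺` the push-forward window laws
of `Ω_δ` and `Ω'_δ` satisfy the two-sided comparison on `O_ε` with one constant `q`. Assembly:
`y(δ) = 1/√3 − m δ·δ ≥ 0` eventually (`m δ·δ → 0`), so `1 ≤ Zloop` (`one_le_zloop`); finitely many
SAWs (`finite_hexDomainSAW`); `O_ε` is open (`hrd_isOpen_avoid`, `K = cl (D ∖ D')` compact) hence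
measurable; then `wrm_pinned_of_pairwise` (mixing specialised at the lattice endpoints `a δ, b δ`)
and `wrm_defect_of_ratioMixing`. Only the first fastness condition is used. -/
theorem stub_windowRestrictionDefect_of_mixing :
    (∀ (D D' : Literature.Probability.RandomPlanarGeometry.DobrushinDomain), D.IsHullSubdomain D' → ∀ (a b : ℝ → Literature.Probability.LatticeModels.HexVertex), Literature.Probability.RandomPlanarGeometry.SAW.IsEmbEndpointApprox Literature.Probability.LatticeModels.hexGraph Literature.Probability.LatticeModels.hexCenter D a b → Literature.Probability.RandomPlanarGeometry.SAW.IsEmbEndpointApprox Literature.Probability.LatticeModels.hexGraph Literature.Probability.LatticeModels.hexCenter D' a b → ∀ ε : ℝ, 0 < ε → ∀ᶠ δ in nhdsWithin 0 (Set.Ioi 0), (∀ γ' : Literature.Probability.RandomPlanarGeometry.SAW.HexDomainSAW D'.carrier δ (a δ) (b δ), ∃ γ : Literature.Probability.RandomPlanarGeometry.SAW.HexDomainSAW D.carrier δ (a δ) (b δ), γ.walk.support = γ'.walk.support) ∧ (∀ γ : Literature.Probability.RandomPlanarGeometry.SAW.HexDomainSAW D.carrier δ (a δ) (b δ), γ.curve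 ∈ {γ : Literature.Probability.RandomPlanarGeometry.CurveClass ℂ | ∀ z ∈ γ.range, ∀ k ∈ closure (D.carrier \ D'.carrier), ε < dist z k} → ∃ γ' : Literature.Probability.RandomPlanarGeometry.SAW.HexDomainSAW D'.carrier δ (a δ) (b δ), γ'.walk.support = γ.walk.support)) → (∀ (m : ℝ → ℝ), Filter.Tendsto (fun δ => m δ * δ) (nhdsWithin 0 (Set.Ioi 0)) (nhds 0) ∧ Filter.Tendsto (fun δ => m δ / Real.log δ⁻¹) (nhdsWithin 0 (Set.Ioi 0)) Filter.atTop → ∀ (D D' : Literature.Probability.RandomPlanarGeometry.DobrushinDomain), D.IsHullSubdomain D' → ∀ ε : ℝ, 0 < ε → ∀ θ : ℝ, 0 < θ → ∀ᶠ δ in nhdsWithin 0 (Set.Ioi 0), ∀ (a b : Literature.Probability.LatticeModels.HexVertex) (γ₁ γ₂ : Literature.Probability.RandomPlanarGeometry.SAW.HexDomainSAW D'.carrier δ a b), γ₁.curve ∈ {γ : Literature.Probability.RandomPlanarGeometry.CurveClass ℂ | ∀ z ∈ γ.range, ∀ k ∈ closure (D.carrier \ D'.carrier), ε < dist z k} →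 γ₂.curve ∈ {γ : Literature.Probability.RandomPlanarGeometry.CurveClass ℂ | ∀ z ∈ γ.range, ∀ k ∈ closure (D.carrier \ D'.carrier), ε < dist z k} → Summit.CriticalPhenomena.SAWScalingLimit.Theorems.SAWMassiveIsingTilt.Zloop (Literature.Probability.RandomPlanarGeometry.SAW.hexDomainGraph D.carrier δ) {v | v ∉ γ₁.walk.support} ((Real.sqrt 3)⁻¹ - m δ * δ) * Summit.CriticalPhenomena.SAWScalingLimit.Theorems.SAWMassiveIsingTilt.Zloop (Literature.Probability.RandomPlanarGeometry.SAW.hexDomainGraph D'.carrier δ) {v | v ∉ γ₂.walk.support} ((Real.sqrt 3)⁻¹ - m δ * δ) ≤ (1 + θ) * (Summit.CriticalPhenomena.SAWScalingLimit.Theorems.SAWMassiveIsingTilt.Zloop (Literature.Probability.RandomPlanarGeometry.SAW.hexDomainGraph D'.carrier δ) {v | v ∉ γ₁.walk.support} ((Real.sqrt 3)⁻¹ - m δ * δ) * Summit.CriticalPhenomena.SAWScalingLimit.Theorems.SAWMassiveIsingTilt.Zloop (Literature.Probability.RandomPlanarGeometry.SAW.hexDomainGraph D.carrier δ) {v | v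 ∉ γ₂.walk.support} ((Real.sqrt 3)⁻¹ - m δ * δ))) → ∀ (m x : ℝ → ℝ), Filter.Tendsto (fun δ => m δ * δ) (nhdsWithin 0 (Set.Ioi 0)) (nhds 0) ∧ Filter.Tendsto (fun δ => m δ / Real.log δ⁻¹) (nhdsWithin 0 (Set.Ioi 0)) Filter.atTop → ∀ (D D' : Literature.Probability.RandomPlanarGeometry.DobrushinDomain), D.IsHullSubdomain D' → ∀ (a b : ℝ → Literature.Probability.LatticeModels.HexVertex), Literature.Probability.RandomPlanarGeometry.SAW.IsEmbEndpointApprox Literature.Probability.LatticeModels.hexGraph Literature.Probability.LatticeModels.hexCenter D a b → Literature.Probability.RandomPlanarGeometry.SAW.IsEmbEndpointApprox Literature.Probability.LatticeModels.hexGraph Literature.Probability.LatticeModels.hexCenter D' a b → ∀ ε : ℝ, 0 < ε → ∀ θ : ℝ, 0 < θ → ∀ᶠ δ in nhdsWithin 0 (Set.Ioi 0), ∃ q : NNReal, ∀ B : Set (Literature.Probability.RandomPlanarGeometry.CurveClass ℂ), MeasurableSet B → (MeasureTheory.Measure.map (fun γ : Literature.Probability.RandomPlanarGeometry.SAW.HexDomainSAW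 D.carrier δ (a δ) (b δ) => γ.curve) (Summit.CriticalPhenomena.SAWScalingLimit.Theorems.SAWMassiveIsingTilt.tiltLaw D.carrier δ (x δ) ((Real.sqrt 3)⁻¹ - m δ * δ) (a δ) (b δ))) (B ∩ {γ : Literature.Probability.RandomPlanarGeometry.CurveClass ℂ | ∀ z ∈ γ.range, ∀ k ∈ closure (D.carrier \ D'.carrier), ε < dist z k}) ≤ ENNReal.ofReal (1 + θ) * (q : ENNReal) * (MeasureTheory.Measure.map (fun γ : Literature.Probability.RandomPlanarGeometry.SAW.HexDomainSAW D'.carrier δ (a δ) (b δ) => γ.curve) (Summit.CriticalPhenomena.SAWScalingLimit.Theorems.SAWMassiveIsingTilt.tiltLaw D'.carrier δ (x δ) ((Real.sqrt 3)⁻¹ - m δ * δ) (a δ) (b δ))) (B ∩ {γ : Literature.Probability.RandomPlanarGeometry.CurveClass ℂ | ∀ z ∈ γ.range, ∀ k ∈ closure (D.carrier \ D'.carrier), ε < dist z k}) ∧ (q : ENNReal) * (MeasureTheory.Measure.map (fun γ : Literature.Probability.RandomPlanarGeometry.SAW.HexDomainSAW D'.carrier δ (a δ) (b δ) => γ.curve)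 (Summit.CriticalPhenomena.SAWScalingLimit.Theorems.SAWMassiveIsingTilt.tiltLaw D'.carrier δ (x δ) ((Real.sqrt 3)⁻¹ - m δ * δ) (a δ) (b δ))) (B ∩ {γ : Literature.Probability.RandomPlanarGeometry.CurveClass ℂ | ∀ z ∈ γ.range, ∀ k ∈ closure (D.carrier \ D'.carrier), ε < dist z k}) ≤ ENNReal.ofReal (1 + θ) * (MeasureTheory.Measure.map (fun γ : Literature.Probability.RandomPlanarGeometry.SAW.HexDomainSAW D.carrier δ (a δ) (b δ) => γ.curve) (Summit.CriticalPhenomena.SAWScalingLimit.Theorems.SAWMassiveIsingTilt.tiltLaw D.carrier δ (x δ) ((Real.sqrt 3)⁻¹ - m δ * δ) (a δ) (b δ))) (B ∩ {γ : Literature.Probability.RandomPlanarGeometry.CurveClass ℂ | ∀ z ∈ γ.range, ∀ k ∈ closure (D.carrier \ D'.carrier), ε < dist z k}) := by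
  intro hN hM m x hfast D D' hDD' a b ha ha' ε hε θ hθ
  have hpos : (0 : ℝ) < (Real.sqrt 3)⁻¹ := by positivity
  have hy : ∀ᶠ δ in 𝓝[>] (0 : ℝ), 0 ≤ (Real.sqrt 3)⁻¹ - m δ * δ := by
    filter_upwards [hfast.1.eventually_mem (Iio_mem_nhds hpos)] with δ hδ
    exact sub_nonneg.2 (le_of_lt hδ)
  have hK : IsCompact (closure (D.carrier \ D'.carrier)) :=
    Metric.isCompact_of_isClosed_isBounded isClosed_closure
      (D.isBounded.subset fun _ h => h.1).closure
  have hO : MeasurableSet {γ : CurveClass ℂ | ∀ z ∈ γ.range,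
      ∀ k ∈ closure (D.carrier \ D'.carrier), ε < dist z k} :=
    (hrd_isOpen_avoid hK ε).measurableSet
  have hev := (hN D D' hDD' a b ha ha' ε hε).and ((hM m hfast D D' hDD' ε hε θ hθ).and
    (hy.and eventually_mem_nhdsWithin))
  refine hev.mono fun δ ⟨hnest, hmixδ, hyδ, hδ⟩ => ?_
  have hδ0 : δ ≠ 0 := (Set.mem_Ioi.1 hδ).ne'
  haveI := ObservableToSLE.Negative.finite_hexDomainSAW D.isBounded hδ0 (a δ) (b δ)
  haveI := ObservableToSLE.Negative.finite_hexDomainSAW D'.isBounded hδ0 (a δ) (b δ)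
  have hZ := one_le_zloop D.isBounded hδ0 hyδ
  have hZ' := one_le_zloop D'.isBounded hδ0 hyδ
  obtain ⟨r₀, hr₀, hmix'⟩ := wrm_pinned_of_pairwise {γ : CurveClass ℂ | ∀ z ∈ γ.range,
    ∀ k ∈ closure (D.carrier \ D'.carrier), ε < dist z k} hZ hZ' (hmixδ (a δ) (b δ))
  exact wrm_defect_of_ratioMixing _ hO hθ.le hZ hZ' hnest.1 hnest.2 hr₀ hmix'

end Summit.CriticalPhenomena.SAWScalingLimit.Theorems.MassiveWindowSLE.Birth

end
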